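import Literature.NumberTheory.GaloisCohomology.LocalInvariantMapEvaluation
import Literature.NumberTheory.GaloisRepresentations.BrauerCyclicLayer
import Literature.NumberTheory.GaloisRepresentations.ArtinCharacterLocalGlobalProofs
import Literature.AnabelianGeometry.AbsoluteAnabelian.AbsAnabProp121viiCupCyclicClass
import HarnessLib

/-!
# A global cyclic class `κₙ(b) ∪ ψ` which vanishes at `v` makes `b` a local norm at `v`
# (Serre, *Corps locaux* XIV §1 Prop. 2–3 with XIII §4; Cassels–Fröhlich VII §9.6)

Let `K` be a number field, `n ≥ 1`, `ψ : Γ_K ↠ ℤ/n` a cyclic character cutting out the finite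
Galois extension `L ⊆ K̄` (`ker ψ = Gal(K̄/L)`), `b ∈ Kˣ`, and `c = κₙ(b) ∪ ψ ∈ H²(Γ_K, μₙ)` the
cup product of the Kummer class of `b` with the crossed homomorphism `σ ↦ (ψ σ)·id ∈ μₙ^∨(1)`
(`Prop121vii.scalarCocycle`) — under `H²(μₙ) → H²(K̄ˣ) = Br(K)` this is minus the class of the
cyclic algebra `(L/K, ψ, b)` (tree `Prop121vii.cohomologyMap_kummerι_cupProduct_δ₀_scalar`).
For a finite place `v` write `K_v L ⊆ K̄_v` for the compositum (the local extension cut out by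
`ψ|Γ_{K_v}`; the `IntermediateField.adjoin` of the tree's `CompletionCompositum.lean`).

* `cohomologyMap_kummerι_resMu` — naturality of `H²(μₙ) → H²(K̄ˣ)` under restriction to `Γ_{K_v}`
  with change of coefficients along `K̄ → K̄_v` (a commuting square of compatible pairs).
* `mem_range_norm_compositum_of_resMu_cupProduct_δ₀_eq_zero` — **if `Res_{K_v/K} c = 0` in
  `H²(Γ_{K_v}, μₙ)` then `b ∈ N_{K_vL/K_v}((K_v L)ˣ)`**: the restriction of the cyclic class
  `κ_ψ(b)` along `Γ_{K_v} → Γ_K` is the cyclic class of the derived character `ψ_v` of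
  `ψ|Γ_{K_v}` (`map_cyclicClass_eq_cyclicClass_derived'`), whose kernel is `Gal(K̄_v / K_v L)`
  (`comap_galFixing_eq`); a vanishing cyclic class is a norm (`κ_{ψ_v}(b) = 0 ⇒ b = N_s y`,
  `exists_cycNorm_eq_of_cyclicClass_eq_zero` with Hilbert 90 for `Gal(K̄_v/K_vL)`,
  `subsingleton_one_units_galFixing`), and `N_s y = N_{K_vL/K_v}(y)` along the layer
  (`prod_pow_smul_eq_algebraMap_norm`) — Serre XIV §1 Prop. 2–3 / XIII §4 Cor.: "`(χ, b) = 0` iff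
  `b` is a norm from the cyclic extension cut out by `χ`".

This is the input at the RAMIFIED places of the sum formula `∑_v inv_v = 0` for cyclic classes
(Tate's proof of the reciprocity law, Cassels–Fröhlich VII §10; there `b` local norm at `v` gives
`ψ_{L|K}(⟨b⟩_v) = 1` by Neukirch VI (5.8), tree `artinIdeleMap_localUnits_eq_one_iff_mem_range_norm`).
Proof file: theorems only, no named fact, no instance (D-0026).

## References

* J.-P. Serre, *Corps locaux* / *Local Fields* (1979), XIII §4 (Cor. to Prop. 13), XIV §1
  Prop. 2–3. [SerreLocalFields1979]
* J. W. S. Cassels, A. Fröhlich (eds.), *Algebraic Number Theory* (1967), Ch. VII (Tate) §9.6,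
  §10. [CasselsFrohlichANT1967]

## Tree search

`lean search 'cohomologyMap_kummerι_resMu|mem_range_norm_compositum_of'`: no prior declaration.
Inputs: `exists_unitsHom`, `Prop121vii.resMu/resCoeff/muRes/cohomologyMap_kummerι_cupProduct_δ₀_scalar`,
`map_cyclicClass_eq_cyclicClass_derived'`, `CyclicCharacter.derived/ker_derived/compOrder`,
`comap_galFixing_eq`, `exists_cycNorm_eq_of_cyclicClass_eq_zero`, `subsingleton_one_units_galFixing`,
`prod_pow_smul_eq_algebraMap_norm`, `cycNorm_ofUnits`, `coe_prod_pow_smul`,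
`ArtinLocalGlobal.finiteDimensional_compositum/isGalois_compositum`, Mathlib
`ContinuousCohomology.map_comp`, `InfiniteGalois.fixedField_fixingSubgroup`.
-/

noncomputable section

open CategoryTheory Function NumberField IsDedekindDomain Field
open scoped NumberField

universe u

namespace Literature.NumberTheory.GaloisCohomology

open _root_.ContinuousCohomology
open Literature.NumberTheory.GaloisRepresentations
open Literature.NumberTheory.GaloisRepresentations.DiscreteGaloisModule
open Literature.NumberTheory.GaloisRepresentations.LocalWeilDatum
open Literature.AnabelianGeometry.AbsoluteAnabelian
open Literature.AnabelianGeometry.AbsoluteAnabelian.Prop121vii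

/-! ### §1. Naturality of `H²(μₙ) → H²(K̄ˣ)` under restriction to a completion -/

section Kummer

variable (F E : Type u) [Field F] [Field E] [Algebra F E] (n : ℕ)

/-- `ContinuousCohomology.map` along equal group homomorphisms and pointwise equal coefficient
morphisms agree. [folklore] -/
private theorem contMap_congr'' {k : Type*} [Ring k] [TopologicalSpace k] {G H : Type u} [Group G]
    [TopologicalSpace G] [IsTopologicalGroup G] [Group H] [TopologicalSpace H] [IsTopologicalGroup H]
    {X : TopRep k G} {Y : TopRep k H} {φ ψ : H →ₜ* G} (h : φ = ψ)
    (f : TopRep.res (φ : H →* G) X ⟶ Y) (g : TopRep.res (ψ : H →* G) X ⟶ Y)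
    (hfg : ∀ x, f.hom x = g.hom x) (m : ℕ) :
    ContinuousCohomology.map φ f m = ContinuousCohomology.map ψ g m := by
  subst h
  have : f = g := TopRep.hom_ext (ContIntertwiningMap.ext (ContinuousLinearMap.ext hfg))
  rw [this]

/-- **Naturality of the Kummer map `H^k(μₙ) → H^k(K̄ˣ)` under restriction with change of
fields.**  For an extension `E/F`, the units morphism `φ : F̄ˣ| → Ēˣ` over `Γ_E → Γ_F` acting as
`u ↦ ι(u)` (`exists_unitsHom`), and every class `x ∈ H^k(Γ_F, μₙ)`:
`Kummer_E (Res_{E/F} x) = H^k(res, φ)(Kummer_F x)` — the coefficient maps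
`μₙ(F̄) → μₙ(Ē) → Ēˣ` and `μₙ(F̄) → F̄ˣ → Ēˣ` agree (both are `ζ ↦ ι(ζ)`), so both sides are the
map on `H^k` of one compatible pair (Mathlib `ContinuousCohomology.map_comp`).
[cite: SerreGaloisCohomology1997, I §2.4] -/
theorem cohomologyMap_kummerι_resMu
    (φ : TopRep.res ((absGaloisRestrict F E : absoluteGaloisGroup E →ₜ* absoluteGaloisGroup F) :
        absoluteGaloisGroup E →* absoluteGaloisGroup F) (units F).toTopRep ⟶ (units E).toTopRep)
    (hφ : ∀ u : (AlgebraicClosure F)ˣ, φ.hom (UnitsCarrier.ofUnits u) =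
      UnitsCarrier.ofUnits (Units.map (absClosureEmbedding F E : AlgebraicClosure F →* AlgebraicClosure E) u))
    (k : ℕ) (x : galoisCohomology (mu F n) k) :
    (cohomologyMap (kummerι E n) k).hom (resMu F E n k x) =
      (ContinuousCohomology.map (absGaloisRestrict F E) φ k).hom ((cohomologyMap (kummerι F n) k).hom x) := by
  have h1 : ContinuousCohomology.map (absGaloisRestrict F E) (resCoeff F E n) k ≫
      ContinuousCohomology.map (ContinuousMonoidHom.id _) (resIdHom (kummerι E n)) k =
    ContinuousCohomology.map (ContinuousMonoidHom.id _) (resIdHom (kummerι F n)) k ≫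
      ContinuousCohomology.map (absGaloisRestrict F E) φ k := by
    rw [← ContinuousCohomology.map_comp, ← ContinuousCohomology.map_comp]
    refine contMap_congr'' (ContinuousMonoidHom.ext fun _ => rfl) _ _ (fun ζ => ?_) k
    change (kummerι E n).hom (muRes F E n ζ) = φ.hom ((kummerι F n).hom ζ)
    change kummerInclAddHom E n (muRes F E n ζ) = φ.hom (kummerInclAddHom F n ζ)
    change UnitsCarrier.ofUnits (muVal E n (muRes F E n ζ)) = φ.hom (UnitsCarrier.ofUnits (muVal F n ζ))
    rw [hφ]
    exact congrArg _ (Units.ext (coe_muVal_muRes F E n ζ))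
  exact congrArg (fun T => (ConcreteCategory.hom T) x) h1

end Kummer

/-! ### §2. Vanishing of the restricted class makes `b` a local norm from the compositum -/

section Norm

variable {K : Type} [Field K] [NumberField K] {n : ℕ} [NeZero n] (v : HeightOneSpectrum (𝓞 K))
  (L : IntermediateField K (AlgebraicClosure K)) [FiniteDimensional K L] [IsAbelianGalois K L]

/-- **`Res_{K_v/K}(κₙ(b) ∪ ψ) = 0 ⇒ b ∈ N_{K_vL/K_v}((K_v L)ˣ)`.**  Let `ψ : Γ_K ↠ ℤ/n` be a cyclic
character with `ker ψ = Gal(K̄/L)` for the finite abelian `L ⊆ K̄`, `b ∈ Kˣ`, and `v` a finite place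
at which the restriction to `Γ_{K_v}` (with coefficients carried along `K̄ → K̄_v`,
`Prop121vii.resMu`) of the global class `κₙ(b) ∪ ψ ∈ H²(Γ_K, μₙ)` vanishes.  Then `b` is a norm
from the compositum `K_v L ⊆ K̄_v`.  Serre XIV §1 Prop. 2–3 with XIII §4: the class `(χ, b)` of the
cyclic algebra vanishes iff `b ∈ N(L_χˣ)`; here read at the completion through the derived
character of `ψ|Γ_{K_v}`, whose fixed field is `K_v L` (`comap_galFixing_eq`), Hilbert 90 for
`Gal(K̄_v/K_vL)` and `κ(a) = 0 ⇒ a = N_s y` (`exists_cycNorm_eq_of_cyclicClass_eq_zero`).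
[cite: SerreLocalFields1979, XIV §1 Prop. 2–3] [cite: CasselsFrohlichANT1967, Ch. VII §9.6] -/
theorem mem_range_norm_compositum_of_resMu_cupProduct_δ₀_eq_zero
    (ψ : CyclicCharacter (absoluteGaloisGroup K) n) (hker : ψ.ker = galFixing K L) (b : Kˣ)
    (h0 : haveI : CompactSpace (absoluteGaloisGroup K) := absoluteGaloisGroup_compactSpace K
      resMu K (v.adicCompletion K) n 2 (((mu K n).tateDualPairing n).cupProduct
        ((isSES_kummer K n (NeZero.pos n)).δ₀ (baseUnitsInvariant K (b : K) b.ne_zero))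
        (oneCocycleClass _ (scalarCocycle ψ))) = 0) :
    globalToLocalUnits v b ∈ (Units.map (Algebra.norm (v.adicCompletion K) :
      (IntermediateField.adjoin (v.adicCompletion K)
        (Set.range ((absClosureEmbedding K (v.adicCompletion K)).comp L.val))) →* v.adicCompletion K)).range := by
  classical
  haveI : CompactSpace (absoluteGaloisGroup K) := absoluteGaloisGroup_compactSpace K
  haveI : CompactSpace (absoluteGaloisGroup (v.adicCompletion K)) :=
    absoluteGaloisGroup_compactSpace (v.adicCompletion K)
  haveI : CharZero (v.adicCompletion K) := charZero_adicCompletion v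
  haveI : IsGalois (v.adicCompletion K) (AlgebraicClosure (v.adicCompletion K)) := IsGalois.mk
  haveI := ArtinLocalGlobal.finiteDimensional_compositum v L
  haveI := ArtinLocalGlobal.isGalois_compositum v L
  -- notation
  set Kv := v.adicCompletion K with hKv
  set ι := absClosureEmbedding K (v.adicCompletion K) with hι
  set Lv := IntermediateField.adjoin (v.adicCompletion K)
    (Set.range ((absClosureEmbedding K (v.adicCompletion K)).comp L.val)) with hLv
  set res := absGaloisRestrict K (v.adicCompletion K) with hres
  -- the units morphism over `res` and the Kummer image of the global class
  obtain ⟨φ, hφ⟩ := exists_unitsHom (F := K) (v.adicCompletion K)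
  set ub := baseUnitsInvariant K (b : K) b.ne_zero with hub
  have hbridge := cohomologyMap_kummerι_cupProduct_δ₀_scalar ψ (scalarCocycle ψ) (scalarCocycle_apply ψ) ub
  -- restriction of the cyclic class `κ_ψ(b)` along `res` vanishes
  have hmap0 : ContinuousCohomology.map res φ 2 (cyclicClass ψ (units K) ub) = 0 := by
    have h := cohomologyMap_kummerι_resMu K (v.adicCompletion K) n φ hφ 2
      (((mu K n).tateDualPairing n).cupProduct ((isSES_kummer K n (NeZero.pos n)).δ₀ ub)
        (oneCocycleClass _ (scalarCocycle ψ)))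
    rw [h0] at h
    have h' : (ContinuousCohomology.map res φ 2).hom (-cyclicClass ψ (units K) ub) = 0 := by
      rw [← hbridge, ← h]; exact map_zero _
    rwa [map_neg, neg_eq_zero] at h'
  -- the image of `b` as a `Γ_{K_v}`-invariant and the derived character
  have ha'inv : ∀ x : absoluteGaloisGroup Kv, (units Kv) x (φ.hom (ub : UnitsCarrier K)) = φ.hom (ub : UnitsCarrier K) := by
    intro x
    have h1 := TopRep.hom_comm_apply φ x (ub : UnitsCarrier K)
    change φ.hom (units K (res x) (ub : UnitsCarrier K)) = (units Kv) x (φ.hom (ub : UnitsCarrier K)) at h1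
    have h2 : units K (res x) (ub : UnitsCarrier K) = ub := ub.2 _
    rw [← h1, h2]
  let a' : (units Kv).toTopRep.ρ.invariants := ⟨φ.hom (ub : UnitsCarrier K), ha'inv⟩
  set bU : (AlgebraicClosure Kv)ˣ := Units.map (ι : AlgebraicClosure K →* AlgebraicClosure Kv)
    (Units.mk0 (algebraMap K (AlgebraicClosure K) (b : K))
      ((map_ne_zero_iff _ (algebraMap K (AlgebraicClosure K)).injective).2 b.ne_zero)) with hbU
  have ha' : (a' : UnitsCarrier Kv) = UnitsCarrier.ofUnits bU := by
    change φ.hom (ub : UnitsCarrier K) = _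
    rw [hbU, ← hφ]
    rfl
  have hbUval : (bU : AlgebraicClosure Kv) = algebraMap Kv (AlgebraicClosure Kv) (algebraMap K Kv (b : K)) := by
    rw [hbU, Units.coe_map, MonoidHom.coe_coe, Units.val_mk0, hι, (absClosureEmbedding K Kv).commutes,
      IsScalarTower.algebraMap_apply K Kv (AlgebraicClosure Kv)]
  set ψ' := ψ.derived res with hψ'def
  have hψ'ker : ψ'.ker = galFixing Kv Lv := by
    rw [hψ'def, CyclicCharacter.ker_derived, hker]
    exact comap_galFixing_eq Kv L
  have hcyc0 : cyclicClass ψ' (units Kv) a' = 0 := by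
    rw [hψ'def, ← map_cyclicClass_eq_cyclicClass_derived' ψ res (units K) (units Kv) φ ub a' rfl]
    exact hmap0
  -- `b ∈ K_v L`
  have hbmem : algebraMap Kv (AlgebraicClosure Kv) (algebraMap K Kv (b : K)) ∈ Lv := by
    have : ι (algebraMap K (AlgebraicClosure K) (b : K)) ∈ Lv :=
      IntermediateField.subset_adjoin _ _ ⟨algebraMap K L (b : K), rfl⟩
    rwa [hι, (absClosureEmbedding K Kv).commutes, IsScalarTower.algebraMap_apply K Kv (AlgebraicClosure Kv)] at this
  -- goal: exhibit `y ∈ (K_v L)ˣ` with `N y = b`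
  suffices hy : ∃ y : Lv, Algebra.norm Kv y = algebraMap K Kv (b : K) by
    obtain ⟨y, hy⟩ := hy
    have hy0 : y ≠ 0 := by
      rintro rfl
      rw [Algebra.norm_zero] at hy
      exact (map_ne_zero_iff _ (algebraMap K Kv).injective).2 b.ne_zero hy.symm
    refine ⟨Units.mk0 y hy0, Units.ext ?_⟩
    rw [Units.coe_map, Units.val_mk0, hy, val_globalToLocalUnits]
  by_cases hn1 : ψ.compOrder res = 1
  · -- trivial local layer: `K_v L = K_v`, and `b = N b`
    refine ⟨⟨_, hbmem⟩, (algebraMap Kv (AlgebraicClosure Kv)).injective ?_⟩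
    have hs : ψ' 1 = 1 := by
      have : Subsingleton (ZMod (ψ.compOrder res)) := by rw [hn1]; infer_instance
      exact Subsingleton.elim _ _
    have h := prod_pow_smul_eq_algebraMap_norm ψ' Lv hψ'ker hs ⟨_, hbmem⟩
    rw [← h, hn1, Finset.prod_range_one, pow_zero, one_smul]
  · -- non-trivial layer: Hilbert 90 and `κ_{ψ'}(b) = 0 ⇒ b = N_s y`
    have hlt : 1 < ψ.compOrder res := lt_of_le_of_ne (ψ.compOrder_pos res) (Ne.symm hn1)
    haveI : Fact (1 < ψ.compOrder res) := ⟨hlt⟩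
    obtain ⟨s, hs⟩ := ψ'.exists_map_eq_one
    have hT : Subsingleton (continuousCohomology 1 (((units Kv).restrict (subgroupIncl ψ'.ker)).toTopRep)) := by
      rw [hψ'ker]
      exact subsingleton_one_units_galFixing _
    obtain ⟨yT, hyT, hyN⟩ := exists_cycNorm_eq_of_cyclicClass_eq_zero ψ' (units Kv) hs hT a' hcyc0
    set yU : (AlgebraicClosure Kv)ˣ := (UnitsCarrier.toAdditive yT).toMul with hyU
    have hyofU : yT = UnitsCarrier.ofUnits yU := rfl
    -- `y ∈ K_v L`: fixed by `ker ψ' = Gal(K̄_v / K_v L)`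
    have hymem : (yU : AlgebraicClosure Kv) ∈ Lv := by
      rw [← InfiniteGalois.fixedField_fixingSubgroup Lv, IntermediateField.mem_fixedField_iff]
      intro g hg
      have hg' : (absoluteGaloisGroup.toAlgEquiv Kv).symm g ∈ ψ'.ker := by
        rw [hψ'ker]; exact hg
      have := hyT _ hg'
      rw [hyofU, units_apply_ofUnits] at this
      have h2 := congrArg (fun w : (AlgebraicClosure Kv)ˣ => (w : AlgebraicClosure Kv)) (ofUnits_injective Kv this)
      rw [Units.coe_smul] at h2
      exact h2
    refine ⟨⟨_, hymem⟩, (algebraMap Kv (AlgebraicClosure Kv)).injective ?_⟩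
    have h := prod_pow_smul_eq_algebraMap_norm ψ' Lv hψ'ker hs ⟨_, hymem⟩
    rw [← h, ← hbUval]
    -- the product `∏ sᵏ • y = b`
    rw [hyofU, cycNorm_ofUnits, ha'] at hyN
    have h2 := congrArg (fun w : (AlgebraicClosure Kv)ˣ => (w : AlgebraicClosure Kv)) (ofUnits_injective Kv hyN)
    change (((∏ k ∈ Finset.range _, (s ^ k) • yU : (AlgebraicClosure Kv)ˣ)) : AlgebraicClosure Kv) = _ at h2
    rw [coe_prod_pow_smul] at h2
    calc ∏ j ∈ Finset.range (ψ.compOrder res), (s ^ j) • ((⟨(yU : AlgebraicClosure Kv), hymem⟩ : Lv) :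
          AlgebraicClosure Kv) = ∏ k ∈ Finset.range (ψ.compOrder res), (s ^ k) • (yU : AlgebraicClosure Kv) := rfl
      _ = _ := h2

end Norm

end Literature.NumberTheory.GaloisCohomology

end
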